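import Literature.Probability.RandomPlanarGeometry.ParaObservableLocalMartingale
import Literature.Probability.RandomPlanarGeometry.ParaObservableLimitPassage
import Literature.Probability.RandomPlanarGeometry.SLELawOfDrivingProcessLocal
import Literature.Probability.RandomPlanarGeometry.SLETransienceKappaEightHolds
import Literature.Probability.RandomPlanarGeometry.DrivingFunctionMeasurable
import HarnessLib

/-!
# Chordal SLE₆ from the limit data of the spin-1/3 observable

Topic `Literature/Probability/RandomPlanarGeometry`; theorems only (no definition, no named
fact). The `κ = 6` (percolation) twin of `LatticeModels/InterfaceSLELimitData.lean` (`κ = 3`,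
spin-Ising): for ONE probability law `ν` on curve classes and ONE chordal uniformizing map `φ`
of a Dobrushin domain `(D; a, b)`, the identification of `ν` as the chordal SLE₆ law from

* **(J′)** `ν`-a.e. Loewner describability through `φ` and source `a`, and convergence in
  distribution in `C([0, ∞), ℝ)` of continuous-path processes `V^k` (the capacity driving
  processes of discrete interfaces, on their own probability spaces) to the driving function
  of `ν` (Kemppainen–Smirnov 2017, Thm. 1.5 / Cor. 1.7; for percolation on `ℤ²` from RSW);
* **(D)** discrete complex martingales approximating, at lattice stopping steps, the
  time-limited spin-1/3 half-plane observable `(iy g_t'(iy)/(g_t(iy) - V^k_t))^{1/3}`,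
  `t ≤ y²/9` (the conditional parafermionic amplitude of the explored domain; Duminil-Copin
  2012, p. 9; Duminil-Copin–Smirnov 2012, §8.3, Conj. 8.7 for its scaling limit),

written with the explicit expression of the observable (literally the body of the percolation
routes' `paraObservableProcess`; no new definition). Results, all PROVED:

* `isSLELaw_six_of_paraCylinderIdentity` — cylinder identity of the time-limited spin-1/3
  observable for a process `W` driving `ν`-a.e. curve through `φ` ⟹ `IsSLELaw 6 D ν`
  (`isLocalMartingale_hasQuadraticVariation_of_paraCylinderIdentity`: `W/√6` is a continuous
  local martingale with `⟨W/√6⟩_t = t`; then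
  `isSLELaw_of_isLocalMartingale_driving_of_ae_tendsto`: Lévy's characterisation, the SLE₆
  trace from its Brownian driver and its a.s. transience, Rohde–Schramm 2005 at `κ = 6 ≠ 8`,
  `tendsto_norm_sleTrace_atTop_of_ne_eight`);
* `exists_paraCylinderIdentityData_of_limitData` — (J′) ∧ (D) ⟹ those data, with
  `W_t(c) = drivingFunction φ c t` (zeroed on the null set of curves not from `a`);
* `isSLELaw_six_of_limitData` — (J′) ∧ (D) ⟹ `IsSLELaw 6 D ν`.

## References

* H. Duminil-Copin, *Divergence of the correlation length for critical planar FK percolation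
  with `1 ≤ q ≤ 4` via parafermionic observables*, J. Phys. A 45 (2012) 494013
  (arXiv:1208.3787), p. 9.
* H. Duminil-Copin, S. Smirnov, *Conformal invariance of lattice models*, Clay Math. Proc. 15
  (2012), §8.3.
* D. Chelkak, H. Duminil-Copin, C. Hongler, A. Kemppainen, S. Smirnov, *Convergence of Ising
  interfaces to Schramm's SLE curves*, C. R. Math. Acad. Sci. Paris 352 (2014), §3.
* A. Kemppainen, S. Smirnov, *Random curves, scaling limits and Loewner evolutions*, Ann.
  Probab. 45 (2017), Thm. 1.5, Cor. 1.7.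
* S. Rohde, O. Schramm, *Basic properties of SLE*, Ann. of Math. 161 (2005), Thms 5.1, 7.1.
-/

noncomputable section

open Set Filter Topology Metric MeasureTheory Complex
open scoped NNReal

namespace Literature.Probability.RandomPlanarGeometry

section SLESix

open UpperHalfPlane (upperHalfPlaneSet)
open Loewner
open scoped Literature.Probability.RandomPlanarGeometry.PathBorel

variable {D : DobrushinDomain} {φ : ConformalEquiv upperHalfPlaneSet D.carrier}
  {ν : Measure (CurveClass ℂ)} [IsProbabilityMeasure ν]

/-- **The spin-1/3 observable's martingale identity identifies chordal SLE₆ (local,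
moment-free form).** Let `φ` be a chordal uniformizing map of the Dobrushin domain `(D; a, b)`,
`ν` a probability measure on curve classes and `W` a real process on `(CurveClass ℂ, ν)`
indexed by `[0, ∞)` with strongly measurable coordinates, continuous paths and `W_0 = 0`,
`ν`-a.e. driving the curve through `φ` (`Loewner.IsDrivenBy`), such that for every `y > 0` the
time-limited spin-1/3 observable process `N^y` satisfies the cylinder identity
`E_ν[(N^y_t - N^y_s) ψ(W_S)] = 0` for all `s ≤ t`, all finite families of times `S ≤ s` and all
continuous `|ψ| ≤ 1`. Then `ν` is the chordal SLE₆ law of `(D; a, b)`: cylinder identity ⟹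
`W/√6` is a continuous local martingale with quadratic variation `t`
(`isLocalMartingale_hasQuadraticVariation_of_paraCylinderIdentity`) ⟹ SLE₆ law
(`isSLELaw_of_isLocalMartingale_driving_of_ae_tendsto`: Lévy's characterisation, the SLE₆
trace from the Brownian driving process and its transience, Rohde–Schramm at `κ = 6 ≠ 8`).
[cite: DuminilCopin2012Parafermion, p. 9] -/
theorem isSLELaw_six_of_paraCylinderIdentity (hφ : D.IsChordalUniformizing φ)
    {W : ℝ≥0 → CurveClass ℂ → ℝ} (hW : ∀ t, StronglyMeasurable (W t))
    (hWc : ∀ c, Continuous (W · c)) (hW0 : ∀ c, W 0 c = 0)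
    (hdrv : ∀ᵐ c ∂ν, Loewner.IsDrivenBy φ.boundaryExtension (D.pt 1) (W · c) c)
    (hcyl : ∀ y : ℝ, 0 < y → ∀ s t : ℝ≥0, s ≤ t → ∀ (n : ℕ) (S : Fin n → ℝ≥0), (∀ k, S k ≤ s) →
      ∀ ψ : (Fin n → ℝ) → ℝ, Continuous ψ → (∀ v, |ψ v| ≤ 1) →
        ∫ c, ((((I * y) * deriv (Loewner.map (fun u ↦ W u c) (min t (cdhksTime y))) (I * y) /
              (Loewner.map (fun u ↦ W u c) (min t (cdhksTime y)) (I * y) - ((W (min t (cdhksTime y)) c : ℝ) : ℂ))) ^ ((3 : ℂ)⁻¹)) - (((I * y) * deriv (Loewner.map (fun u ↦ W u c) (min s (cdhksTime y))) (I * y) /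
                    (Loewner.map (fun u ↦ W u c) (min s (cdhksTime y)) (I * y) - ((W (min s (cdhksTime y)) c : ℝ) : ℂ))) ^ ((3 : ℂ)⁻¹))) * (ψ (fun k ↦ W (S k) c) : ℂ) ∂ν = 0) :
    IsSLELaw 6 D ν := by
  obtain ⟨hloc, hQ⟩ :=
    isLocalMartingale_hasQuadraticVariation_of_paraCylinderIdentity (P := ν) hW hWc hW0 hcyl
  have hsq : Real.sqrt ((6 : ℝ≥0) : ℝ) = Real.sqrt 6 := by norm_num
  refine isSLELaw_of_isLocalMartingale_driving_of_ae_tendsto (κ := 6) (by norm_num)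
    (tendsto_norm_sleTrace_atTop_of_ne_eight (by norm_num) (by norm_num)) hφ
    (W := fun c t ↦ W t c) (fun t ↦ (hW t).measurable) (ae_of_all _ hW0) (ae_of_all _ hWc)
    (𝓕 := Filtration.natural W hW) ?_ ?_ hdrv
  · simpa only [hsq] using hloc
  · simpa only [hsq] using hQ

variable {Ω' : ℕ → Type*} {mΩ' : ∀ k, MeasurableSpace (Ω' k)} {P : ∀ k, Measure (Ω' k)}
  [∀ k, IsProbabilityMeasure (P k)] {V : ∀ k, ℝ≥0 → Ω' k → ℝ}

/-- **The moment-free cylinder-identity data for one subsequential limit, from the limit data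
(J′) ∧ (D) for the spin-1/3 observable.** Inputs, for a chordal uniformizing map `φ` of
`(D; a, b)` and a probability measure `ν` on curve classes: (J′) `ν`-a.e. curve class is
describable by the Loewner evolution through `φ` and starts at `a`; the continuous-path
processes `V^k` (on their own probability spaces) converge in distribution in `C([0, ∞), ℝ)` to
the driving function of the limit; and (D) the discrete observable martingale data of
`integral_paraObservableProcess_cylinder_eq_zero_of_discreteMartingales` for every `y > 0`.
Output: a process `W` on `(CurveClass ℂ, ν)` with strongly measurable marginals, continuous
paths, `W_0 = 0`, `ν`-a.e. driving the curve, and the cylinder identity of the time-limited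
spin-1/3 observable — namely `W_t(c) = drivingFunction φ c t` for curves from `a` and `0`
otherwise. (Percolation twin of `exists_spinCylinderIdentityData_of_limitData`.)
[cite: DuminilCopin2012Parafermion, p. 9] -/
theorem exists_paraCylinderIdentityData_of_limitData (hφ : D.IsChordalUniformizing φ)
    (hdesc : ∀ᵐ c ∂ν, IsLoewnerDescribable φ c) (hsrc : ∀ᵐ c ∂ν, c.source = D.pt 0)
    (hVc : ∀ k ω, Continuous (V k · ω))
    (hlaw : TendstoInDistribution (fun k ω ↦ (⟨fun u ↦ V k u ω, hVc k ω⟩ : C(ℝ≥0, ℝ))) atTop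
      (fun c ↦ (⟨drivingFunction φ c, continuous_drivingFunction φ c⟩ : C(ℝ≥0, ℝ))) P ν)
    (hD : ∀ y : ℝ, 0 < y → ∀ s t : ℝ≥0, s < t → t < cdhksTime y →
      ∃ (C' : ℝ) (ε Δ η : ℕ → ℝ≥0), Tendsto ε atTop (𝓝 0) ∧ Tendsto Δ atTop (𝓝 0) ∧
        Tendsto η atTop (𝓝 0) ∧
        ∀ k, ∃ (𝒢 : Filtration ℕ (mΩ' k)) (F : ℕ → Ω' k → ℂ) (σ τ : Ω' k → WithTop ℕ)
          (hσ : IsStoppingTime 𝒢 σ) (M : ℕ) (bad : Set (Ω' k)),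
          IsStoppingTime 𝒢 τ ∧ Martingale F 𝒢 (P k) ∧ σ ≤ τ ∧ (∀ ω, τ ω ≤ M) ∧
          (∀ u, u ≤ s → Measurable[hσ.measurableSpace] (V k u)) ∧
          (∀ᵐ ω ∂P k, ‖stoppedValue F σ ω‖ ≤ C') ∧ (∀ᵐ ω ∂P k, ‖stoppedValue F τ ω‖ ≤ C') ∧
          MeasurableSet bad ∧ P k bad ≤ η k ∧
          ∀ᵐ ω ∂P k, ω ∉ bad →
            (∃ u ∈ Icc s (s + Δ k), ‖stoppedValue F σ ω - (((I * y) * deriv (Loewner.map (fun u ↦ (V k) u ω) (min u (cdhksTime y))) (I * y) /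
                  (Loewner.map (fun u ↦ (V k) u ω) (min u (cdhksTime y)) (I * y) - (((V k) (min u (cdhksTime y)) ω : ℝ) : ℂ))) ^ ((3 : ℂ)⁻¹))‖ ≤ ε k) ∧
            (∃ u ∈ Icc t (t + Δ k), ‖stoppedValue F τ ω - (((I * y) * deriv (Loewner.map (fun u ↦ (V k) u ω) (min u (cdhksTime y))) (I * y) /
                  (Loewner.map (fun u ↦ (V k) u ω) (min u (cdhksTime y)) (I * y) - (((V k) (min u (cdhksTime y)) ω : ℝ) : ℂ))) ^ ((3 : ℂ)⁻¹))‖ ≤ ε k)) :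
    ∃ W : ℝ≥0 → CurveClass ℂ → ℝ,
      (∀ t, StronglyMeasurable (W t)) ∧ (∀ c, Continuous (W · c)) ∧ (∀ c, W 0 c = 0) ∧
      (∀ᵐ c ∂ν, Loewner.IsDrivenBy φ.boundaryExtension (D.pt 1) (W · c) c) ∧
      ∀ y : ℝ, 0 < y → ∀ s t : ℝ≥0, s ≤ t → ∀ (n : ℕ) (S : Fin n → ℝ≥0), (∀ k, S k ≤ s) →
        ∀ ψ : (Fin n → ℝ) → ℝ, Continuous ψ → (∀ v, |ψ v| ≤ 1) →
          ∫ c, ((((I * y) * deriv (Loewner.map (fun u ↦ W u c) (min t (cdhksTime y))) (I * y) /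
                (Loewner.map (fun u ↦ W u c) (min t (cdhksTime y)) (I * y) - ((W (min t (cdhksTime y)) c : ℝ) : ℂ))) ^ ((3 : ℂ)⁻¹)) - (((I * y) * deriv (Loewner.map (fun u ↦ W u c) (min s (cdhksTime y))) (I * y) /
                      (Loewner.map (fun u ↦ W u c) (min s (cdhksTime y)) (I * y) - ((W (min s (cdhksTime y)) c : ℝ) : ℂ))) ^ ((3 : ℂ)⁻¹))) * (ψ (fun k ↦ W (S k) c) : ℂ) ∂ν = 0 := by
  classical
  -- the driving function, zeroed on the (null) set of curves not starting at `a`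
  set W : ℝ≥0 → CurveClass ℂ → ℝ :=
    fun t c ↦ if c.source = D.pt 0 then drivingFunction φ c t else 0 with hWdef
  have hWeq : ∀ {c : CurveClass ℂ}, c.source = D.pt 0 → (W · c) = drivingFunction φ c := by
    intro c hc
    funext t
    simp [hWdef, hc]
  have hWeq' : ∀ {c : CurveClass ℂ}, c.source = D.pt 0 → ∀ t, W t c = drivingFunction φ c t := by
    intro c hc t
    simp [hWdef, hc]
  have hWae : ∀ᵐ c ∂ν, (W · c) = drivingFunction φ c := by
    filter_upwards [hsrc] with c hc
    exact hWeq hc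
  have hWm : ∀ t, StronglyMeasurable (W t) := fun t ↦
    (Measurable.ite (CurveClass.isClosed_setOf_source_eq (D.pt 0)).measurableSet
      (measurable_drivingFunction_apply hφ t) measurable_const).stronglyMeasurable
  have hWc : ∀ c, Continuous (W · c) := by
    intro c
    by_cases hc : c.source = D.pt 0
    · rw [hWeq hc]
      exact continuous_drivingFunction φ c
    · have : (W · c) = 0 := by
        funext t
        simp [hWdef, hc]
      rw [this]
      exact continuous_const
  have hW0 : ∀ c, W 0 c = 0 := by
    intro c
    by_cases hc : c.source = D.pt 0
    · rw [hWeq' hc]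
      exact drivingFunction_apply_zero hφ hc
    · simp [hWdef, hc]
  -- convergence in distribution to the paths of `W`
  have hlaw' : TendstoInDistribution (fun k ω ↦ (⟨fun u ↦ V k u ω, hVc k ω⟩ : C(ℝ≥0, ℝ))) atTop
      (fun c ↦ (⟨fun u ↦ W u c, hWc c⟩ : C(ℝ≥0, ℝ))) P ν := by
    refine hlaw.congr (fun k ↦ EventuallyEq.rfl) ?_
    filter_upwards [hWae] with c hc
    ext u
    simp only [ContinuousMap.coe_mk]
    rw [← hc]
  refine ⟨W, hWm, hWc, hW0, ?_, fun y hy ↦ ?_⟩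
  · -- a.e. the curve is driven by `W · c`
    filter_upwards [hdesc, hsrc] with c hd hs
    rw [hWeq hs]
    exact (isLoewnerDescribed_drivingFunction hd).2
  · -- the cylinder identity, by the passage theorem
    exact integral_paraObservableProcess_cylinder_eq_zero_of_discreteMartingales (W := W)
      hWc hVc hlaw' hy (hD y hy)

/-- **(J′) ∧ (D) for the spin-1/3 observable ⟹ the subsequential limit is chordal SLE₆**
(for one limit law `ν` and one chordal uniformizing map `φ`): the `κ = 6` twin of
`LatticeModels.isSLELaw_three_of_limitData` — `exists_paraCylinderIdentityData_of_limitData`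
followed by `isSLELaw_six_of_paraCylinderIdentity`. Inputs: `ν`-a.e. Loewner describability
through `φ` and source `a`; convergence in distribution of continuous-path processes `V^k` to
the driving function of `ν`; the discrete martingale approximation of the time-limited
spin-1/3 half-plane observable `(iy g_t'(iy)/(g_t(iy) - W_t))^{1/3}`, `t ≤ y²/9`. Output:
`IsSLELaw 6 D ν`. [cite: DuminilCopin2012Parafermion, p. 9] -/
theorem isSLELaw_six_of_limitData (hφ : D.IsChordalUniformizing φ)
    (hdesc : ∀ᵐ c ∂ν, IsLoewnerDescribable φ c) (hsrc : ∀ᵐ c ∂ν, c.source = D.pt 0)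
    (hVc : ∀ k ω, Continuous (V k · ω))
    (hlaw : TendstoInDistribution (fun k ω ↦ (⟨fun u ↦ V k u ω, hVc k ω⟩ : C(ℝ≥0, ℝ))) atTop
      (fun c ↦ (⟨drivingFunction φ c, continuous_drivingFunction φ c⟩ : C(ℝ≥0, ℝ))) P ν)
    (hD : ∀ y : ℝ, 0 < y → ∀ s t : ℝ≥0, s < t → t < cdhksTime y →
      ∃ (C' : ℝ) (ε Δ η : ℕ → ℝ≥0), Tendsto ε atTop (𝓝 0) ∧ Tendsto Δ atTop (𝓝 0) ∧
        Tendsto η atTop (𝓝 0) ∧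
        ∀ k, ∃ (𝒢 : Filtration ℕ (mΩ' k)) (F : ℕ → Ω' k → ℂ) (σ τ : Ω' k → WithTop ℕ)
          (hσ : IsStoppingTime 𝒢 σ) (M : ℕ) (bad : Set (Ω' k)),
          IsStoppingTime 𝒢 τ ∧ Martingale F 𝒢 (P k) ∧ σ ≤ τ ∧ (∀ ω, τ ω ≤ M) ∧
          (∀ u, u ≤ s → Measurable[hσ.measurableSpace] (V k u)) ∧
          (∀ᵐ ω ∂P k, ‖stoppedValue F σ ω‖ ≤ C') ∧ (∀ᵐ ω ∂P k, ‖stoppedValue F τ ω‖ ≤ C') ∧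
          MeasurableSet bad ∧ P k bad ≤ η k ∧
          ∀ᵐ ω ∂P k, ω ∉ bad →
            (∃ u ∈ Icc s (s + Δ k), ‖stoppedValue F σ ω - (((I * y) * deriv (Loewner.map (fun u ↦ (V k) u ω) (min u (cdhksTime y))) (I * y) /
                  (Loewner.map (fun u ↦ (V k) u ω) (min u (cdhksTime y)) (I * y) - (((V k) (min u (cdhksTime y)) ω : ℝ) : ℂ))) ^ ((3 : ℂ)⁻¹))‖ ≤ ε k) ∧
            (∃ u ∈ Icc t (t + Δ k), ‖stoppedValue F τ ω - (((I * y) * deriv (Loewner.map (fun u ↦ (V k) u ω) (min u (cdhksTime y))) (I * y) /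
                  (Loewner.map (fun u ↦ (V k) u ω) (min u (cdhksTime y)) (I * y) - (((V k) (min u (cdhksTime y)) ω : ℝ) : ℂ))) ^ ((3 : ℂ)⁻¹))‖ ≤ ε k)) :
    IsSLELaw 6 D ν := by
  obtain ⟨W, hW, hWc, hW0, hdrv, hcyl⟩ :=
    exists_paraCylinderIdentityData_of_limitData hφ hdesc hsrc hVc hlaw hD
  exact isSLELaw_six_of_paraCylinderIdentity hφ hW hWc hW0 hdrv hcyl

end SLESix

end Literature.Probability.RandomPlanarGeometry
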